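import Literature.Barriers.QuantumAdvantage.TensorNetworkContractionGraph
import Literature.Combinatorics.SimpleGraph.TreeDecomposition
import HarnessLib

/-!
# Barrier catalogue `QuantumAdvantage` — treewidth of the circuit graph: Markov–Shi's contraction theorem (Thm 4.6) typed, and Cor 1.2 / Prop 5.1 reduced to it and to Robertson–Seymour

Companion to `TensorNetworkContraction.lean` (the barrier block) and
`TensorNetworkContractionGraph.lean` (the circuit graph `G_C` and the bags). Contents:

* `treewidth_circuitGraph_le` — **the combinatorial content of Markov–Shi's Prop. 5.1**: if,
  under some linear ordering `σ` of the wires, at most `r` gates cross every cut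
  (`QCircuit.cutParamUnder σ C ≤ r`), then `treewidth (circuitGraph C) ≤ 2r + 1`. The printed
  proof takes the path of bags `B_1 — ⋯ — B_{n-1}`, `B_i` = the multi-qubit gates crossing cut
  `i`, on the graph with inputs/outputs deleted and one-qubit gates suppressed, "hence
  `tw(G_C) = tw(G) = O(r)`"; as recorded in the design notes of the barrier file, its (T2) needs
  the bags `B_{i-1} ∪ B_i`, and we decompose `G_C` itself (no suppression lemma needed) by the
  grid of bags `bagAt C σ i j = B_i ∪ B_{i-1} ∪ around(wire at position i, time j)` read
  position by position (`Literature.Combinatorics.SimpleGraph.treewidth_le_of_grid`), each of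
  size `≤ 2r + 2` (`card_bagAt_le`).
* `RootedTreeDecomposition G k`, `RootedTreeDecomposition.encode`, `CircuitNode.code` — tree
  decompositions in the normal form handed to a machine (bag indices `0, …, k-1`, a parent array
  with `parent i < i`, (T3) as "a vertex of bag `i` lying in an earlier bag lies in the bag of
  `parent i`"), proved to be `Literature.Combinatorics.SimpleGraph.TreeDecomposition`s of the
  same width (`toTreeDecomposition`, `treewidth_le_width`), and their Boolean codes over the
  node numbering `CircuitNode.code`.
* `markovShi2008_thm46` — **Markov–Shi's contraction theorem, Thm 4.6 (rigorous form of
  Thm 1.1) with the tree decomposition of its Step 2 supplied**, at the language level (named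
  fact, D-0014): a language decided with bounded error by a uniform polynomial-size oracle-free
  Clifford+T family `C_n` for which a polynomial-time function `1ⁿ ↦ 𝒯_n` supplies rooted tree
  decompositions of the circuit graphs `G_{C_n}` of width `≤ c·log₂ n + c` is in `P`. This is
  what §3–4 of the paper prove (Steps 1, 3, 4 of the proof of Thm 4.6: Props 3.5, 3.6, 4.2 and
  Lemma 4.4 — "the minimal cost of contraction is determined by the treewidth"); Step 2, the
  Robertson–Seymour approximation (Thm 4.3, cited from [RSX]), is NOT part of the fact.
  (Restated 2026-08-15 at the review of the decomposition of `markovShi2008_prop51`, D-0026: the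
  first version carried the bare hypothesis `tw(G_{C_n}) ≤ c·log₂ n + c` and thus silently
  included Thm 4.3, a theory-sized external algorithm absent from the library; that statement
  is now the conclusion of `markovShi2008_cor12_of_thm46`.)
* `markovShi2008_cor12_of_thm46` — **Cor 1.2 / Thm 1.1 as printed** (logarithmic treewidth, no
  decomposition supplied, `⟹ P`) from `markovShi2008_thm46` and the explicit Robertson–Seymour
  hypothesis `hRS` (Thm 4.3 read for uniform families: circuit graphs of treewidth
  `≤ c·log₂ n + c` admit `FP`-computable rooted decompositions of width `≤ c'·log₂ n + c'`).
* `markovShi2008_prop51_anyOrder_of_thm46` — Prop. 5.1 in the ORDERING-FREE form at the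
  language level (hypothesis: for every `n` SOME linear ordering of the wires of `C_n` has cut
  parameter `≤ c·log₂ n + c`, no ordering being handed to the decider; conclusion `L ∈ P`) from
  the same two inputs, along the printed derivation: "Hence `tw(G_C) = tw(G) = O(r)`, which by
  Theorem 1.1 implies that `C` can be simulated in `T^{O(1)} exp[O(r)]` time"
  (`treewidth_circuitGraph_le`). The ordering being hidden, the decider must find a decomposition
  itself, whence the Robertson–Seymour hypothesis: this form is Thm 1.1 INCLUDING its Step 2.
  The conclusion is spelled out, not named (2026-08-15, review of the decomposition of the
  barrier file's named fact `markovShi2008_prop51`, D-0026: up to then this theorem was called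
  `markovShi2008_prop51_of_thm46` and concluded that named fact, which was the ordering-free
  form; the review restates the named fact — companion proposal on the barrier file — with
  the qubit indexing SUPPLIED — the source's
  "whose qubits are indexed by `[n]`" — so that its discharge from `markovShi2008_thm46` is the
  explicit path decomposition of the printed proof of Prop 5.1 made effective, with no call to
  Thm 4.3; this file no longer depends on which statement that name denotes, and the
  ordering-free form, which implies the supplied-ordering one, survives as this conclusion).

What remains for `markovShi2008_thm46` (no graph algorithm involved) is the machine-level
content of §3–4: Prop 3.5 (the contracted network is the probability — landed as
`acceptProb_eq_value_segmentNetwork`, `TensorNetworkContractionSegments.lean`), Lemma 4.4 (the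
decomposition `𝒯*` of the line graph from that of `G_C` — landed as `segDecomposition`,
`TensorNetworkContractionSegmentsTreewidth.lean`), Prop 4.2 (orderings from tree
decompositions) and Prop 3.6 (cost of contracting along an ordering of maximum rank `d`),
assembled as a polynomial-time TM2 decider with exact arithmetic in `ℤ[ζ₈, 1/√2]` (tables of
`4^{O(log n)}` entries). What remains for the ordering-free Prop 5.1 beyond that is Thm 4.3
(Robertson–Seymour), which the library does not have in any form; for Prop 5.1 with the
indexing supplied it is instead the effective form of the printed path decomposition — an `FP`
function `1ⁿ ↦ 𝒯_n` listing the bags `bagAt (F.circ n) σ_n i j` of `treewidth_circuitGraph_le`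
in lexicographic order as a `RootedTreeDecomposition` (a path: `parent t = t - 1`) of width
`≤ 2(c·log₂ n + c) + 1`, to be fed to `markovShi2008_thm46` (not yet in the tree).

## References

* [MarkovShi2008] I. L. Markov, Y. Shi, *Simulating quantum computation by contracting tensor
  networks*, SIAM J. Comput. 38 (2008) 963–981 (arXiv:quant-ph/0511069): §1 (Thm 1.1, Cor 1.2,
  p. 3), §2 (tree decompositions (T1)–(T3), p. 5), §3 (Props 3.5, 3.6, pp. 7–8), §4 (Def 4.1,
  Prop 4.2, Thm 4.3, Lemma 4.4, Thm 4.5, Thm 4.6 and its four-step proof, pp. 9–10 of the arXiv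
  version), §5 (Prop 5.1 and its proof, p. 11). Read via `lit read paper:arxiv-quant-ph_0511069`.
* [RobertsonSeymour1986] N. Robertson, P. D. Seymour, *Graph minors. II*, J. Algorithms 7 (1986)
  (tree-width). The approximation algorithm of Markov–Shi's Thm 4.3 is cited by them as [RSX]
  = N. Robertson, P. D. Seymour, *Graph minors. X. Obstructions to tree-decomposition*,
  J. Combin. Theory Ser. B 52 (1991) 153–190; it enters this file only as the hypothesis `hRS`.
* [AroraBarak2009] S. Arora, B. Barak, *Computational Complexity: A Modern Approach*, CUP 2009,
  §0.1 (representing objects as strings; the codes of `RootedTreeDecomposition.encode`).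
-/

namespace Literature.Barriers.QuantumAdvantage

open Literature.Computability.Cryptography Literature.Combinatorics.SimpleGraph

variable {G : QGateSet} {N : ℕ}

/-! ### Gates spanning a position; single-wire nodes -/

/-- `Spans σ i g`: the gate `g` acts on some wire at position `≤ i` and on some wire at position
`≥ i` of the ordering `σ` (so a gate acting on positions `i₁ < ⋯ < i_k` spans exactly the
positions `i₁ ≤ i ≤ i_k`, the range over which it must sit in the bags). [folklore] -/
def Spans (σ : Fin N ≃ Fin N) (i : ℕ) (g : QGate G N) : Prop :=
  (∃ j ∈ g.wires, ((σ j : Fin N) : ℕ) ≤ i) ∧ (∃ j' ∈ g.wires, i ≤ ((σ j' : Fin N) : ℕ))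

/-- The positions spanned by a gate form an interval. [folklore] -/
theorem Spans.of_le_of_le {σ : Fin N ≃ Fin N} {i₁ i i₂ : ℕ} {g : QGate G N} (h₁ : Spans σ i₁ g)
    (h₂ : Spans σ i₂ g) (hi₁ : i₁ ≤ i) (hi₂ : i ≤ i₂) : Spans σ i g :=
  ⟨h₁.1.imp fun _ ⟨hj, h⟩ => ⟨hj, h.trans hi₁⟩, h₂.2.imp fun _ ⟨hj, h⟩ => ⟨hj, hi₂.trans h⟩⟩

/-- A gate crossing the cut after `i` spans position `i`. [folklore] -/
theorem Crosses.spans {σ : Fin N ≃ Fin N} {i : ℕ} {g : QGate G N} (h : Crosses σ i g) :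
    Spans σ i g :=
  ⟨h.1, h.2.imp fun _ ⟨hj, h⟩ => ⟨hj, h.le⟩⟩

/-- A gate crossing the cut after `i - 1` spans position `i`. [folklore] -/
theorem Crosses.spans_of_pred {σ : Fin N ≃ Fin N} {i : ℕ} {g : QGate G N}
    (h : Crosses σ (i - 1) g) : Spans σ i g :=
  ⟨h.1.imp fun _ ⟨hj, h⟩ => ⟨hj, h.trans (Nat.sub_le i 1)⟩, h.2.imp fun _ ⟨hj, h⟩ => ⟨hj, by omega⟩⟩

/-- Conversely, a gate acting on two distinct positions and spanning position `i` crosses the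
cut after `i` or the cut after `i - 1` (Markov–Shi: "if `u` acts on qubits `i₁ < ⋯ < i_k` then
`u ∈ B_i` for all `i₁ ≤ i < i_k`"). [cite: MarkovShi2008, §5 (proof of Prop 5.1)] -/
theorem Spans.crosses_or {σ : Fin N ≃ Fin N} {i : ℕ} {g : QGate G N} (h : Spans σ i g)
    (h2 : ∃ a ∈ g.wires, ∃ b ∈ g.wires, ((σ a : Fin N) : ℕ) < ((σ b : Fin N) : ℕ)) :
    Crosses σ i g ∨ Crosses σ (i - 1) g := by
  obtain ⟨⟨a₀, ha₀, hai⟩, ⟨b₀, hb₀, hib⟩⟩ := h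
  obtain ⟨a₁, ha₁, b₁, hb₁, hab⟩ := h2
  by_cases hlt : i < ((σ b₀ : Fin N) : ℕ)
  · exact Or.inl ⟨⟨a₀, ha₀, hai⟩, ⟨b₀, hb₀, hlt⟩⟩
  by_cases hlt' : ((σ a₀ : Fin N) : ℕ) < i
  · exact Or.inr ⟨⟨a₀, ha₀, by omega⟩, ⟨b₀, hb₀, by omega⟩⟩
  by_cases hb₁i : i < ((σ b₁ : Fin N) : ℕ)
  · exact Or.inl ⟨⟨a₀, ha₀, hai⟩, ⟨b₁, hb₁, hb₁i⟩⟩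
  · exact Or.inr ⟨⟨a₁, ha₁, by omega⟩, ⟨b₀, hb₀, by omega⟩⟩

/-- A gate node acting on two distinct positions lies in the bag at `(i, j)` iff its gate spans
position `i` (whatever `j`). [cite: MarkovShi2008, §5 (proof of Prop 5.1)] -/
theorem gate_mem_bagAt_iff_spans {C : QCircuit G N} {σ : Fin N ≃ Fin N} {i : Fin N} {j : ℕ}
    {t : Fin C.gates.length}
    (h2 : ∃ a ∈ (C.gates[(t : ℕ)]).wires, ∃ b ∈ (C.gates[(t : ℕ)]).wires,
      ((σ a : Fin N) : ℕ) < ((σ b : Fin N) : ℕ)) :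
    CircuitNode.gate t ∈ bagAt C σ i j ↔ Spans σ i C.gates[(t : ℕ)] := by
  rw [mem_bagAt, gate_mem_crossNodes, gate_mem_crossNodes]
  constructor
  · rintro (h | h | h)
    · exact h.spans
    · exact h.spans_of_pred
    · have hw : OnWire C (σ.symm i) (.gate t) := onWire_of_mem_around h
      simp only [OnWire] at hw
      exact ⟨⟨σ.symm i, hw, by simp⟩, ⟨σ.symm i, hw, by simp⟩⟩
  · intro h
    rcases h.crosses_or h2 with h | h
    · exact Or.inl h
    · exact Or.inr (Or.inl h)

/-- `SingleWire C u`: the node `u` lies on at most one wire (inputs, outputs, one-qubit gates).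
[folklore] -/
def SingleWire (C : QCircuit G N) (u : CircuitNode C.gates.length N) : Prop :=
  ∀ ⦃w w' : Fin N⦄, OnWire C w u → OnWire C w' u → w = w'

/-- Input nodes are single-wire. [folklore] -/
theorem singleWire_input (C : QCircuit G N) (w : Fin N) : SingleWire C (.input w) :=
  fun a b ha hb => by simp only [OnWire] at ha hb; rw [← ha, ← hb]

/-- Output nodes are single-wire. [folklore] -/
theorem singleWire_output (C : QCircuit G N) (w : Fin N) : SingleWire C (.output w) :=
  fun a b ha hb => by simp only [OnWire] at ha hb; rw [← ha, ← hb]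

/-- A single-wire node crosses no cut. [folklore] -/
theorem SingleWire.not_mem_crossNodes {C : QCircuit G N} {σ : Fin N ≃ Fin N} {i : ℕ}
    {u : CircuitNode C.gates.length N} (hu : SingleWire C u) : u ∉ crossNodes C σ i := by
  rw [mem_crossNodes]
  rintro ⟨t, rfl, ⟨a, ha, hai⟩, ⟨b, hb, hib⟩⟩
  have hab : a = b := hu ha hb
  subst hab
  omega

/-- A single-wire node lies in the bag at `(i, j)` iff it is one of the nodes of the wire at
position `i` around time `j`. [folklore] -/
theorem SingleWire.mem_bagAt_iff {C : QCircuit G N} {σ : Fin N ≃ Fin N} {i : Fin N} {j : ℕ}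
    {u : CircuitNode C.gates.length N} (hu : SingleWire C u) :
    u ∈ bagAt C σ i j ↔ u ∈ around C (σ.symm i) j := by
  rw [mem_bagAt]
  simp [hu.not_mem_crossNodes]

/-- A gate node that is not single-wire acts on two wires at distinct positions. [folklore] -/
theorem exists_lt_of_not_singleWire {C : QCircuit G N} {t : Fin C.gates.length}
    (h : ¬ SingleWire C (.gate t)) (σ : Fin N ≃ Fin N) :
    ∃ a ∈ (C.gates[(t : ℕ)]).wires, ∃ b ∈ (C.gates[(t : ℕ)]).wires,
      ((σ a : Fin N) : ℕ) < ((σ b : Fin N) : ℕ) := by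
  simp only [SingleWire, not_forall, exists_prop] at h
  obtain ⟨a, b, ha, hb, hab⟩ := h
  simp only [OnWire] at ha hb
  have hne : ((σ a : Fin N) : ℕ) ≠ ((σ b : Fin N) : ℕ) := fun h' => hab (σ.injective (Fin.ext h'))
  rcases Nat.lt_or_gt_of_ne hne with hlt | hlt
  · exact ⟨a, ha, b, hb, hlt⟩
  · exact ⟨b, hb, a, ha, hlt⟩

/-- Every node lies on some wire, provided every gate acts on at least one wire. [folklore] -/
theorem exists_onWire {C : QCircuit G N} (hC : ∀ g ∈ C.gates, g.wires.Nonempty)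
    (u : CircuitNode C.gates.length N) : ∃ w, OnWire C w u := by
  cases u with
  | input w => exact ⟨w, rfl⟩
  | gate t =>
    obtain ⟨a, ha⟩ := hC _ (List.getElem_mem t.isLt)
    exact ⟨a, ha⟩
  | output w => exact ⟨w, rfl⟩

/-! ### The treewidth bound (Markov–Shi, proof of Prop 5.1) -/

/-- **`tw(G_C) = O(r)`** (the combinatorial content of Markov–Shi's Prop. 5.1): if every gate
acts on at least one wire and, under the linear ordering `σ` of the wires, at most
`r = cutParamUnder σ C` gates cross every cut, then the circuit graph has treewidth at most
`2r + 1` — witnessed by the path decomposition whose bags are `bagAt C σ i j`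
(`B_i ∪ B_{i-1}` plus the two nodes of the wire at position `i` around time `j`), read position
by position and, within a position, time by time. The source's bags `B_i` alone give width
`r - 1` on the suppressed graph but miss (T2) for a segment of wire `i` leaving the top wire of a
gate; the union with `B_{i-1}` repairs this at the cost of the factor `2`.
[cite: MarkovShi2008, §5 (Prop 5.1, proof: "Hence tw(G_C) = tw(G) = O(r)")] -/
theorem treewidth_circuitGraph_le (σ : Fin N ≃ Fin N) (C : QCircuit G N)
    (hC : ∀ g ∈ C.gates, g.wires.Nonempty) :
    treewidth (circuitGraph C) ≤ 2 * C.cutParamUnder σ + 1 := by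
  classical
  rcases Nat.eq_zero_or_pos N with hN | hN
  · -- no wires: no nodes at all
    subst hN
    have hno : ∀ u : CircuitNode C.gates.length 0, False := by
      intro u
      obtain ⟨w, -⟩ := exists_onWire hC u
      exact w.elim0
    exact treewidth_le_of_intervals _ (fun _ : Fin 1 => ∅) (fun u => (hno u).elim)
      (fun u => (hno u).elim) (fun u => (hno u).elim) fun _ => by simp
  -- bags on the grid (position `i < N`, time boundary `j ≤ T`)
  set B : ℕ → ℕ → Finset (CircuitNode C.gates.length N) :=
    fun i j => if h : i < N then bagAt C σ ⟨i, h⟩ j else ∅ with hB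
  have hBi : ∀ (i : Fin N) (j : ℕ), B i j = bagAt C σ i j := fun i j => by
    simp [hB, i.isLt]
  refine treewidth_le_of_grid (circuitGraph C) hN (Nat.succ_pos C.gates.length) B
    ?_ ?_ ?_ fun i hi j _ => ?_
  · -- (T2): a wire segment lies in the bag at (its position, the stamp of its earlier end)
    intro u v huv
    rw [circuitGraph_adj] at huv
    rcases huv.2 with ⟨w, hc⟩ | ⟨w, hc⟩
    · have hlt : u.pos < C.gates.length + 1 := lt_of_lt_of_le hc.2.2.1 v.pos_le
      refine ⟨σ w, (σ w).isLt, u.pos, hlt, ?_⟩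
      rw [hBi, mem_bagAt, mem_bagAt, Equiv.symm_apply_apply]
      exact ⟨Or.inr (Or.inr hc.ends_mem_around.1), Or.inr (Or.inr hc.ends_mem_around.2)⟩
    · have hlt : v.pos < C.gates.length + 1 := lt_of_lt_of_le hc.2.2.1 u.pos_le
      refine ⟨σ w, (σ w).isLt, v.pos, hlt, ?_⟩
      rw [hBi, mem_bagAt, mem_bagAt, Equiv.symm_apply_apply]
      exact ⟨Or.inr (Or.inr hc.ends_mem_around.2), Or.inr (Or.inr hc.ends_mem_around.1)⟩
  · -- (T1): every node lies on a wire, hence in `around` at some time boundary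
    intro u
    obtain ⟨w, hw⟩ := exists_onWire hC u
    obtain ⟨j, hj, hju⟩ := exists_mem_around hw
    refine ⟨σ w, (σ w).isLt, j, Nat.lt_succ_of_le hj, ?_⟩
    rw [hBi, mem_bagAt, Equiv.symm_apply_apply]
    exact Or.inr (Or.inr hju)
  · -- (T3): the bags containing a node form a lexicographic interval
    intro u i₁ j₁ i j i₂ j₂ hi₁ _ hi _ hi₂ _ hl₁ hl₂ hu₁ hu₂
    rw [show B i₁ j₁ = bagAt C σ ⟨i₁, hi₁⟩ j₁ from dif_pos hi₁] at hu₁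
    rw [show B i₂ j₂ = bagAt C σ ⟨i₂, hi₂⟩ j₂ from dif_pos hi₂] at hu₂
    rw [show B i j = bagAt C σ ⟨i, hi⟩ j from dif_pos hi]
    by_cases hs : SingleWire C u
    · -- single-wire nodes: only via `around`, on one position, an interval of times
      rw [hs.mem_bagAt_iff] at hu₁ hu₂ ⊢
      have hw := hs (onWire_of_mem_around hu₁) (onWire_of_mem_around hu₂)
      have h12 : i₁ = i₂ := by simpa using congrArg (fun w => ((σ w : Fin N) : ℕ)) hw
      subst h12
      have hii : i = i₁ := by omega
      subst hii
      exact mem_around_of_mem_of_mem hu₁ hu₂ (by omega) (by omega)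
    · -- multi-wire gates: via `Spans`, an interval of positions (all times)
      cases u with
      | input w => exact absurd (singleWire_input C w) hs
      | output w => exact absurd (singleWire_output C w) hs
      | gate t =>
        have h2 := exists_lt_of_not_singleWire hs σ
        rw [gate_mem_bagAt_iff_spans h2] at hu₁ hu₂ ⊢
        exact hu₁.of_le_of_le hu₂ (show i₁ ≤ i by omega) (show i ≤ i₂ by omega)
  · -- width
    rw [show B i j = bagAt C σ ⟨i, hi⟩ j from dif_pos hi]
    have := card_bagAt_le C σ ⟨i, hi⟩ j
    omega

end Literature.Barriers.QuantumAdvantage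

/-! ### Rooted tree decompositions and their codes (the output of Step 2 of Markov–Shi's Thm 4.6) -/

noncomputable section

open Computability Literature.Computability.Complexity Literature.Computability.Complexity.Classes

namespace Literature.Barriers.QuantumAdvantage

open Literature.Computability.Cryptography Literature.Combinatorics.SimpleGraph

/-- A **rooted tree decomposition** of the simple graph `G` on the bag indices `0, …, k-1`
(`0 < k`): the tree is given by a parent map with `parent i < i` for `i ≠ 0` (so `0` is the root
and children carry larger indices than their parents), with (T2) both ends of every edge of `G`
in a common bag, (T1) every vertex in some bag, and (T3) in rooted form: a vertex of the bag `i`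
that also lies in some bag of smaller index lies in the bag of `parent i` (equivalently, the
bags containing a vertex form a subtree: `connected_induce`, `toTreeDecomposition`). This is the
normal form in which a tree decomposition is handed to a machine — a parent array and the list
of bags, `encode`. It is a `Literature.Combinatorics.SimpleGraph.TreeDecomposition` of the same
width (`toTreeDecomposition`, `width_toTreeDecomposition`, `treewidth_le_width`); conversely
(a remark, not needed and not proved here) every tree decomposition is brought to this form,
with the same bags, by a breadth-first renumbering of its tree from any root. Kept next to its
one user, the hypothesis of `markovShi2008_thm46` (the decomposition computed in Step 2 of the
proof of Markov–Shi's Thm 4.6 and consumed by Steps 3–4).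
[cite: MarkovShi2008, §2 (tree decompositions, (T1)–(T3), width) and §4 (proof of Thm 4.6, Step 2)] -/
structure RootedTreeDecomposition {V : Type*} (G : SimpleGraph V) (k : ℕ) where
  /-- There is at least one bag index (the root `0`). -/
  pos : 0 < k
  /-- The parent of a bag index (its value at the root is irrelevant). -/
  parent : Fin k → Fin k
  /-- Parents carry smaller indices. -/
  parent_lt : ∀ i : Fin k, 0 < (i : ℕ) → ((parent i : Fin k) : ℕ) < i
  /-- The bag of vertices of `G` at each index. -/
  bag : Fin k → Finset V
  /-- (T2): both ends of an edge of `G` lie in a common bag. -/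
  exists_mem_bag_of_adj : ∀ ⦃u v : V⦄, G.Adj u v → ∃ t, u ∈ bag t ∧ v ∈ bag t
  /-- (T1): every vertex lies in some bag. -/
  exists_mem_bag : ∀ v : V, ∃ t, v ∈ bag t
  /-- (T3), rooted form: a vertex of the bag `i` lying also in an earlier bag lies in the bag
  of the parent of `i`. -/
  mem_bag_parent : ∀ (v : V) (i : Fin k), v ∈ bag i → (∃ j, v ∈ bag j ∧ (j : ℕ) < i) →
    v ∈ bag (parent i)

namespace RootedTreeDecomposition

variable {V : Type*} {G : SimpleGraph V} {k : ℕ}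

/-- The root index `0`. [folklore] -/
def root (D : RootedTreeDecomposition G k) : Fin k := ⟨0, D.pos⟩

/-- The **width** of a rooted decomposition: the largest bag size minus one.
[cite: MarkovShi2008, §2 (width of a tree decomposition)] -/
def width (D : RootedTreeDecomposition G k) : ℕ :=
  (Finset.univ.sup fun t => (D.bag t).card) - 1

/-- Every bag has at most `width + 1` vertices. [cite: MarkovShi2008, §2] -/
theorem card_bag_le_width_add_one (D : RootedTreeDecomposition G k) (t : Fin k) :
    (D.bag t).card ≤ D.width + 1 := by
  have h : (D.bag t).card ≤ Finset.univ.sup fun t => (D.bag t).card :=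
    Finset.le_sup (f := fun t => (D.bag t).card) (Finset.mem_univ t)
  unfold width
  omega

/-- The **trivial rooted decomposition** of a finite graph: a single bag, the root, holding
every vertex. [folklore] -/
def trivial [Fintype V] (G : SimpleGraph V) : RootedTreeDecomposition G 1 where
  pos := Nat.one_pos
  parent _ := 0
  parent_lt i hi := by exfalso; have := i.isLt; omega
  bag _ := Finset.univ
  exists_mem_bag_of_adj _ _ _ := ⟨0, Finset.mem_univ _, Finset.mem_univ _⟩
  exists_mem_bag v := ⟨0, Finset.mem_univ v⟩
  mem_bag_parent _ _ _ _ := Finset.mem_univ _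

/-- The trivial rooted decomposition has width `|V| - 1`. [folklore] -/
theorem width_trivial [Fintype V] (G : SimpleGraph V) :
    (trivial G).width = Fintype.card V - 1 := by
  simp [width, trivial]

/-- The **tree** of a rooted decomposition: every index `i ≠ 0` is joined to `parent i`.
[folklore] -/
def tree (D : RootedTreeDecomposition G k) : SimpleGraph (Fin k) :=
  SimpleGraph.fromRel fun i j => 0 < (i : ℕ) ∧ D.parent i = j

/-- Adjacency in the tree of a rooted decomposition. [folklore] -/
theorem tree_adj (D : RootedTreeDecomposition G k) {i j : Fin k} :
    D.tree.Adj i j ↔ i ≠ j ∧ ((0 < (i : ℕ) ∧ D.parent i = j) ∨ (0 < (j : ℕ) ∧ D.parent j = i)) :=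
  SimpleGraph.fromRel_adj _ _ _

/-- A non-root index is adjacent to its parent. [folklore] -/
theorem adj_parent (D : RootedTreeDecomposition G k) {i : Fin k} (hi : 0 < (i : ℕ)) :
    D.tree.Adj i (D.parent i) := by
  refine D.tree_adj.2 ⟨fun h => ?_, Or.inl ⟨hi, rfl⟩⟩
  have hlt := D.parent_lt i hi
  rw [← h] at hlt
  exact lt_irrefl _ hlt

/-- Every index of value `n` reaches the root along parents (induction on `n`). [folklore] -/
theorem reachable_root_of_eq (D : RootedTreeDecomposition G k) :
    ∀ (n : ℕ) (i : Fin k), (i : ℕ) = n → D.tree.Reachable i D.root := by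
  intro n
  induction n using Nat.strong_induction_on with
  | _ n ih =>
    intro i hi
    rcases Nat.eq_zero_or_pos n with hn | hn
    · subst hn
      have : i = D.root := Fin.ext hi
      subst this
      rfl
    · have hi0 : 0 < (i : ℕ) := hi ▸ hn
      have hlt : ((D.parent i : Fin k) : ℕ) < n := hi ▸ D.parent_lt i hi0
      exact (D.adj_parent hi0).reachable.trans (ih _ hlt (D.parent i) rfl)

/-- Every index reaches the root along parents. [folklore] -/
theorem reachable_root (D : RootedTreeDecomposition G k) (i : Fin k) :
    D.tree.Reachable i D.root :=
  D.reachable_root_of_eq _ i rfl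

/-- The tree of a rooted decomposition is connected. [folklore] -/
theorem tree_connected (D : RootedTreeDecomposition G k) : D.tree.Connected :=
  (SimpleGraph.connected_iff _).2
    ⟨fun a b => (D.reachable_root a).trans (D.reachable_root b).symm, ⟨D.root⟩⟩

/-- The tree of a rooted decomposition on `k` indices has `k - 1` edges `{i, parent i}`,
`0 < i < k`. [folklore] -/
theorem card_edgeSet_tree (D : RootedTreeDecomposition G k) :
    Nat.card D.tree.edgeSet + 1 = k := by
  classical
  -- the edges are in bijection with the non-root indices
  set f : {i : Fin k // 0 < (i : ℕ)} → D.tree.edgeSet := fun i =>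
    ⟨s((i : Fin k), D.parent i), (SimpleGraph.mem_edgeSet _).2 (D.adj_parent i.2)⟩ with hf
  have hbij : Function.Bijective f := by
    constructor
    · rintro ⟨a, ha⟩ ⟨b, hb⟩ hab
      simp only [hf, Subtype.mk.injEq, Sym2.eq_iff] at hab
      rcases hab with ⟨h, -⟩ | ⟨h1, h2⟩
      · exact Subtype.ext h
      · exfalso
        have hpa := D.parent_lt a ha
        have hpb := D.parent_lt b hb
        have e1 := congrArg Fin.val h1
        have e2 := congrArg Fin.val h2
        omega
    · rintro ⟨e, he⟩
      induction e using Sym2.ind with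
      | _ u v =>
        rw [SimpleGraph.mem_edgeSet, tree_adj] at he
        rcases he.2 with ⟨hu, huv⟩ | ⟨hv, hvu⟩
        · exact ⟨⟨u, hu⟩, Subtype.ext (by simp [hf, huv])⟩
        · exact ⟨⟨v, hv⟩, Subtype.ext (by simp [hf, hvu, Sym2.eq_swap])⟩
  rw [← Nat.card_eq_of_bijective f hbij, Nat.card_eq_fintype_card, Fintype.card_subtype]
  have hfilter : (Finset.univ.filter fun i : Fin k => 0 < (i : ℕ)) = Finset.univ.erase D.root := by
    ext i
    simp only [Finset.mem_filter, Finset.mem_univ, true_and, Finset.mem_erase, Ne, and_true,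
      root, Fin.ext_iff]
    omega
  rw [hfilter, Finset.card_erase_of_mem (Finset.mem_univ _), Finset.card_univ, Fintype.card_fin]
  have := D.pos
  omega

/-- The tree of a rooted decomposition is a tree (connected with `k - 1` edges on `k`
vertices). [folklore] -/
theorem isTree (D : RootedTreeDecomposition G k) : D.tree.IsTree := by
  rw [SimpleGraph.isTree_iff_connected_and_card]
  exact ⟨D.tree_connected, by rw [D.card_edgeSet_tree, Nat.card_eq_fintype_card, Fintype.card_fin]⟩

/-- (T3): the indices whose bags contain a given vertex induce a connected subtree — every such
index is joined, along parents whose bags still contain the vertex, to the least one. [folklore] -/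
theorem connected_induce (D : RootedTreeDecomposition G k) (v : V) :
    (D.tree.induce {t | v ∈ D.bag t}).Connected := by
  classical
  set S : Set (Fin k) := {t | v ∈ D.bag t} with hS
  set M : Finset (Fin k) := Finset.univ.filter fun t => v ∈ D.bag t with hM
  have hMne : M.Nonempty := by
    obtain ⟨t, ht⟩ := D.exists_mem_bag v
    exact ⟨t, by simp [hM, ht]⟩
  set m : Fin k := M.min' hMne with hm
  have hmS : v ∈ D.bag m := by
    have := Finset.min'_mem M hMne
    rw [← hm] at this
    simpa [hM] using this
  have hmin : ∀ t, v ∈ D.bag t → m ≤ t := fun t ht =>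
    hm ▸ Finset.min'_le M t (by simp [hM, ht])
  -- every index of `S` reaches `m` inside `S`
  have hreach : ∀ (n : ℕ) (i : Fin k) (hi : v ∈ D.bag i), (i : ℕ) = n →
      (D.tree.induce S).Reachable ⟨i, hi⟩ ⟨m, hmS⟩ := by
    intro n
    induction n using Nat.strong_induction_on with
    | _ n ih =>
      intro i hi hin
      by_cases him : i = m
      · subst him
        rfl
      · have hmi : (m : ℕ) < i := by
          have h1 : m ≤ i := hmin i hi
          rw [Fin.le_def] at h1
          have h2 : (m : ℕ) ≠ i := fun h => him (Fin.ext h.symm)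
          omega
        have hi0 : 0 < (i : ℕ) := by omega
        have hp : v ∈ D.bag (D.parent i) := D.mem_bag_parent v i hi ⟨m, hmS, hmi⟩
        have hadj : (D.tree.induce S).Adj ⟨i, hi⟩ ⟨D.parent i, hp⟩ := by
          rw [SimpleGraph.induce_adj]
          exact D.adj_parent hi0
        have hlt : ((D.parent i : Fin k) : ℕ) < n := hin ▸ D.parent_lt i hi0
        exact hadj.reachable.trans (ih _ hlt (D.parent i) hp rfl)
  refine (SimpleGraph.connected_iff _).2 ⟨fun a b => ?_, ⟨⟨m, hmS⟩⟩⟩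
  exact (hreach _ a.1 a.2 rfl).trans (hreach _ b.1 b.2 rfl).symm

/-- **A rooted tree decomposition is a tree decomposition** (same bags, the tree of parents).
[cite: MarkovShi2008, §2 ((T1)–(T3))] -/
def toTreeDecomposition (D : RootedTreeDecomposition G k) : TreeDecomposition G (Fin k) where
  tree := D.tree
  isTree := D.isTree
  bag := D.bag
  exists_mem_bag_of_adj := D.exists_mem_bag_of_adj
  connected_induce := D.connected_induce

/-- The bags of `toTreeDecomposition` are the given ones. [folklore] -/
@[simp] theorem toTreeDecomposition_bag (D : RootedTreeDecomposition G k) (t : Fin k) :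
    D.toTreeDecomposition.bag t = D.bag t :=
  rfl

/-- `toTreeDecomposition` preserves the width. [folklore] -/
theorem width_toTreeDecomposition (D : RootedTreeDecomposition G k) :
    D.toTreeDecomposition.width = D.width :=
  rfl

/-- **The treewidth is at most the width of any rooted tree decomposition.**
[cite: MarkovShi2008, §2 (treewidth)] -/
theorem treewidth_le_width [Fintype V] (D : RootedTreeDecomposition G k) :
    treewidth G ≤ D.width :=
  D.width_toTreeDecomposition ▸ Combinatorics.SimpleGraph.treewidth_le_width D.toTreeDecomposition

end RootedTreeDecomposition

/-- **Numbering of the circuit nodes** for machine consumption: on `N` wires with `T` gates,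
`input w ↦ w`, `gate t ↦ N + t`, `output w ↦ N + T + w` (so the codes are `< 2N + T`, and a
machine holding the description `⟨n, m, C⟩` of the circuit, `N = n + m`, `T = |C|`, reads off
the kind and the index of a node from its code). [folklore] -/
def CircuitNode.code {T N : ℕ} : CircuitNode T N → ℕ
  | .input w => w
  | .gate t => N + t
  | .output w => N + T + w

/-- The node numbering is injective. [folklore] -/
theorem CircuitNode.code_injective {T N : ℕ} :
    Function.Injective (CircuitNode.code (T := T) (N := N)) := by
  rintro (a | a | a) (b | b | b) h <;> simp only [CircuitNode.code] at h
  · rw [Fin.ext h]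
  · have := a.isLt; omega
  · have := a.isLt; omega
  · have := b.isLt; omega
  · have h' : (a : ℕ) = b := by omega
    rw [Fin.ext h']
  · have := a.isLt; omega
  · have := b.isLt; omega
  · have := b.isLt; omega
  · have h' : (a : ℕ) = b := by omega
    rw [Fin.ext h']

/-- **The code of a rooted tree decomposition of a circuit graph**: the pair (self-delimiting
`boolPair`) of the parent array `[parent 0, …, parent (k-1)]` (a list of naturals,
`encodingListNatBool`; its length is the number `k` of bags) and of the list of the `k` bags,
each the increasing list of the codes (`CircuitNode.code`) of its nodes
(`encodingListNatBool.listBool`). [cite: AroraBarak2009, §0.1 (representing objects as strings)] -/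
def RootedTreeDecomposition.encode {T N k : ℕ} {G : SimpleGraph (CircuitNode T N)}
    (D : RootedTreeDecomposition G k) : List Bool :=
  (encodingListNatBool.pairBool encodingListNatBool.listBool).encode
    (List.ofFn fun i : Fin k => ((D.parent i : Fin k) : ℕ),
     List.ofFn fun i : Fin k => ((D.bag i).image CircuitNode.code).sort)

/-! ### Markov–Shi's contraction theorem (Thm 4.6 given the decomposition of its Step 2), and Cor 1.2 / Prop 5.1 reduced to it and to Robertson–Seymour -/

/-- **Markov–Shi 2008, Theorem 4.6 (the rigorous form of Thm 1.1) — the contraction theorem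
proper, i.e. Steps 1, 3, 4 of its proof, with the tree decomposition of Step 2 supplied**,
language-level reading in the style of `markovShi2008_cor15` / `markovShi2008_prop51`.
As printed, Thm 4.6: "the probability that `τ` is realized on `C(ρ_x)` can be computed
deterministically in time `T^{O(1)} exp[O(cc(G_C))] = T^{O(1)} exp[O(tw(G_C))]`", by the
algorithm "1. Construct `N = N(C; x, τ)`. 2. Apply the Robertson–Seymour algorithm to compute a
tree decomposition `𝒯` of `N*` of width `w = O(tw(N*))` (Theorem 4.3). 3. Find a contraction
ordering `π` from `𝒯` (Proposition 4.2) of width `w`. 4. Contract `N` using `π`, and output the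
desired probability from the final (rank-0) tensor (Proposition 3.5)", Step 4 costing
`O(T exp[O(d)])` for orderings of maximum rank `d` (Proposition 3.6) and `tw(N*)` being
`O(tw(G_C))` for bounded-degree `G_C` (Lemma 4.4). Step 2 is Robertson–Seymour's theorem
(Thm 4.3, cited there from [RSX]), an external input which the paper does not prove and this
library does not have; Steps 1, 3, 4 are what §3–4 prove. Hence, reading "given `𝒯`" at the
language level: a language decided with error `≤ 1/3` by a poly-time uniform, polynomial-size,
oracle-free Clifford+T family `C_n` for which some polynomial-time function `1ⁿ ↦ 𝒯_n`
supplies rooted tree decompositions of the circuit graphs `G_{C_n}` (`circuitGraph`,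
`RootedTreeDecomposition.encode`) of width `≤ c·log₂ n + c` is in `P` — the decider generates
`C_n` (uniformity) and `𝒯_n`, turns `𝒯_n` into the decomposition `𝒯*` of the line graph
(Lemma 4.4: bags of `≤ 5(c log₂ n + c + 1)` wire segments, `segDecomposition` /
`treewidth_primalGraph_segmentNetwork_le` in `TensorNetworkContractionSegmentsTreewidth.lean`),
contracts `N(C_n; x, τ)` along it with exact arithmetic in `ℤ[ζ₈, 1/√2]` (tensors of rank
`O(log n)` over the 4-letter index set, `n^{O(c)}` entries; the value is the acceptance
probability by Prop 3.5, `acceptProb_eq_value_segmentNetwork`) and compares with `1/2`.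
The treewidth form as printed (Cor 1.2: logarithmic treewidth, no decomposition supplied) is
this statement plus Step 2: `markovShi2008_cor12_of_thm46`; the ordering-free Prop 5.1 follows
likewise, `markovShi2008_prop51_anyOrder_of_thm46`. (Restated 2026-08-15 at the review of the decomposition of
`markovShi2008_prop51` (D-0026): the 2026-08-15T00:58Z version of this fact had the bare
hypothesis `tw(G_{C_n}) ≤ c·log₂ n + c`, i.e. it included Robertson–Seymour; that statement
is now the conclusion of `markovShi2008_cor12_of_thm46`.)
[cite: MarkovShi2008, §4 (Thm 4.6 and its proof, Steps 1, 3, 4; Prop 4.2; Lemma 4.4), §3 (Props 3.5, 3.6), §1 (Thm 1.1, Cor 1.2)] -/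
def markovShi2008_thm46 : Prop :=
  ∀ (c : ℕ) (F : QCircuitFamily cliffordT) (L : Language Bool),
    F.IsOracleFree → F.IsUniform → F.IsPolySize →
    (∃ d : List Bool → List Bool, d ∈ FP ∧ ∀ n,
      ∃ (k : ℕ) (D : RootedTreeDecomposition (circuitGraph (F.circ n)) k),
        D.width ≤ c * Nat.log 2 n + c ∧ d (unaryEncodeNat n) = D.encode) →
    (∀ x, (x ∈ L → 2 / 3 ≤ F.acceptProbOn 0 x) ∧ (x ∉ L → F.acceptProbOn 0 x ≤ 1 / 3)) →
    L ∈ P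

/-- The families covered by `markovShi2008_thm46` have circuit graphs of logarithmic treewidth
(`RootedTreeDecomposition.treewidth_le_width`): the supplied-decomposition hypothesis refines
the bare treewidth hypothesis of Cor 1.2, so the restated fact is implied by the printed
theorem. [cite: MarkovShi2008, §1 (Cor 1.2)] -/
theorem treewidth_le_of_rootedTreeDecompositions {c : ℕ} {F : QCircuitFamily cliffordT}
    (hD : ∃ d : List Bool → List Bool, d ∈ FP ∧ ∀ n,
      ∃ (k : ℕ) (D : RootedTreeDecomposition (circuitGraph (F.circ n)) k),
        D.width ≤ c * Nat.log 2 n + c ∧ d (unaryEncodeNat n) = D.encode) (n : ℕ) :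
    treewidth (circuitGraph (F.circ n)) ≤ c * Nat.log 2 n + c := by
  obtain ⟨d, -, h⟩ := hD
  obtain ⟨k, D, hw, -⟩ := h n
  exact D.treewidth_le_width.trans hw

/-- Every placed gate over Clifford+T (and every oracle query) acts on at least one wire: the
arities of `H, S, T, CNOT` are `1, 1, 1, 2`. [folklore] -/
theorem wires_nonempty_cliffordT {N : ℕ} (g : QGate cliffordT N) : g.wires.Nonempty := by
  cases g with
  | gate op e =>
    have h : 0 < cliffordT.arity op := by cases op <;> decide
    exact ⟨e ⟨0, h⟩, Finset.mem_map_of_mem _ (Finset.mem_univ _)⟩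
  | oracle k e => exact ⟨e 0, Finset.mem_map_of_mem _ (Finset.mem_univ _)⟩

/-- **Cor 1.2 / Thm 1.1 as printed (logarithmic treewidth, no decomposition supplied) from the
contraction theorem and Robertson–Seymour.** The hypothesis `hRS` is Step 2 of the proof of
Thm 4.6 read at the level of uniform families: "There is a deterministic algorithm that given a
graph `G` outputs a tree decomposition of `G` of width `O(tw(G))` in time
`|V(G)|^{O(1)} exp[O(tw(G))]`" (Thm 4.3, Robertson and Seymour [RSX]) — applied to the
circuit graphs `G_{C_n}` of a uniform family (computable from `1ⁿ` in polynomial time, of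
polynomial size) of treewidth `≤ c·log₂ n + c` it runs in time polynomial in `n`, and a
breadth-first renumbering roots its output, so some `FP` function supplies rooted
decompositions of width `≤ c'·log₂ n + c'`. Given that, a language decided with bounded error
by a uniform polynomial-size oracle-free Clifford+T family of logarithmic treewidth is in `P`
("Any polynomial-size quantum circuit of a logarithmic treewidth can be simulated
deterministically in polynomial time", Cor 1.2). The library has no form of Thm 4.3, which is
why it is a hypothesis here and not a theorem. [cite: MarkovShi2008, §1 (Thm 1.1, Cor 1.2) and §4 (Thm 4.3, Thm 4.6 Step 2)] -/
theorem markovShi2008_cor12_of_thm46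
    (hRS : ∀ (c : ℕ) (F : QCircuitFamily cliffordT), F.IsUniform →
      (∀ n, treewidth (circuitGraph (F.circ n)) ≤ c * Nat.log 2 n + c) →
      ∃ c' : ℕ, ∃ d : List Bool → List Bool, d ∈ FP ∧ ∀ n,
        ∃ (k : ℕ) (D : RootedTreeDecomposition (circuitGraph (F.circ n)) k),
          D.width ≤ c' * Nat.log 2 n + c' ∧ d (unaryEncodeNat n) = D.encode)
    (h : markovShi2008_thm46) :
    ∀ (c : ℕ) (F : QCircuitFamily cliffordT) (L : Language Bool),
      F.IsOracleFree → F.IsUniform → F.IsPolySize →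
      (∀ n, treewidth (circuitGraph (F.circ n)) ≤ c * Nat.log 2 n + c) →
      (∀ x, (x ∈ L → 2 / 3 ≤ F.acceptProbOn 0 x) ∧ (x ∉ L → F.acceptProbOn 0 x ≤ 1 / 3)) →
      L ∈ P := by
  intro c F L hOF hU hPS hTw hDec
  obtain ⟨c', d, hd, hD⟩ := hRS c F hU hTw
  exact h c' F L hOF hU hPS ⟨d, hd, hD⟩ hDec

/-- **Prop 5.1 in the ordering-free form, from the contraction theorem and Robertson–Seymour**,
the source's derivation made formal: under an ordering with cut parameter `r ≤ c·log₂ n + c` the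
circuit graph has treewidth `≤ 2r + 1 ≤ (2c+1)·log₂ n + (2c+1)` (`treewidth_circuitGraph_le`), so
the treewidth form `markovShi2008_cor12_of_thm46` applies ("Hence `tw(G_C) = tw(G) = O(r)`,
which by Theorem 1.1 implies that `C` can be simulated in `T^{O(1)} exp[O(r)]` time"). Here the
ordering is hidden (for every `n` one exists, none is given), so the decider must find a
decomposition itself, whence the Robertson–Seymour hypothesis `hRS` (Thm 4.3, see
`markovShi2008_cor12_of_thm46`); the conclusion — a language decided with bounded error by a
uniform polynomial-size oracle-free Clifford+T family whose circuits have cut parameter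
`≤ c·log₂ n + c` under SOME ordering of their wires is in `P` — is spelled out rather than named
(it is the 2026-08-14 statement of the barrier file's `markovShi2008_prop51`, which the review
of its decomposition (2026-08-15, D-0026) restates with the indexing supplied — companion
proposal on the barrier file; this theorem was `markovShi2008_prop51_of_thm46` up to then). The barrier file derives the ordering-free Cor 1.5
(`markovShi2008_cor15_anyOrder`) from this conclusion (`QCircuit.cutParamUnder_le`), so the chain
`Thm 4.6 → Prop 5.1 (ordering-free) → Cor 1.5` consists of theorems, relative to Thm 4.3.
[cite: MarkovShi2008, §5 (proof of Prop 5.1) and §4 (Thm 4.3)] -/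
theorem markovShi2008_prop51_anyOrder_of_thm46
    (hRS : ∀ (c : ℕ) (F : QCircuitFamily cliffordT), F.IsUniform →
      (∀ n, treewidth (circuitGraph (F.circ n)) ≤ c * Nat.log 2 n + c) →
      ∃ c' : ℕ, ∃ d : List Bool → List Bool, d ∈ FP ∧ ∀ n,
        ∃ (k : ℕ) (D : RootedTreeDecomposition (circuitGraph (F.circ n)) k),
          D.width ≤ c' * Nat.log 2 n + c' ∧ d (unaryEncodeNat n) = D.encode)
    (h : markovShi2008_thm46) :
    ∀ (c : ℕ) (F : QCircuitFamily cliffordT) (L : Language Bool),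
      F.IsOracleFree → F.IsUniform → F.IsPolySize →
      (∀ n, ∃ σ : Fin (n + F.ancillas n) ≃ Fin (n + F.ancillas n),
        (F.circ n).cutParamUnder σ ≤ c * Nat.log 2 n + c) →
      (∀ x, (x ∈ L → 2 / 3 ≤ F.acceptProbOn 0 x) ∧ (x ∉ L → F.acceptProbOn 0 x ≤ 1 / 3)) →
      L ∈ P := by
  intro c F L hOF hU hPS hCut hDec
  refine markovShi2008_cor12_of_thm46 hRS h (2 * c + 1) F L hOF hU hPS (fun n => ?_) hDec
  obtain ⟨σ, hσ⟩ := hCut n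
  have htw := treewidth_circuitGraph_le σ (F.circ n) fun g _ => wires_nonempty_cliffordT g
  have hmono : 2 * c * Nat.log 2 n ≤ (2 * c + 1) * Nat.log 2 n :=
    Nat.mul_le_mul_right _ (Nat.le_succ _)
  calc treewidth (circuitGraph (F.circ n)) ≤ 2 * (F.circ n).cutParamUnder σ + 1 := htw
    _ ≤ 2 * (c * Nat.log 2 n + c) + 1 := by omega
    _ = 2 * c * Nat.log 2 n + (2 * c + 1) := by ring
    _ ≤ (2 * c + 1) * Nat.log 2 n + (2 * c + 1) := Nat.add_le_add_right hmono _

end Literature.Barriers.QuantumAdvantage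

end
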